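import Summits.AtomisticToContinuum.Crystallization.Theorems.ChessboardParticlePlanesPeriodicWindowsOfGoodWindows

/-!
# Crux `PeriodicWindows` (stmt-AtomisticToContinuum-3240) — line `Sketch`, lead skeleton rev 11

Lead: prover-line-stmt-AtomisticToContinuum-3240-c5-0 (continuation c5 of …-3240-0 rev 1–4, …-c1-0 rev 5–7b,
…-c2-0 rev 8, …-c3-0 rev 9, …-c4-0 rev 10).

REV 11 = REV 10 SLIMMED. Rev 10 is LANDED in full except its input: the tree file
`Theorems/ChessboardParticlePlanesPeriodicWindowsOfGoodWindows.lean` (p136275) carries `goodWindow_frequently`,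
`barlowWindows_of_goodWindows`, `PeriodicWindows_of_goodWindowsAE`, `LayeredWindows_of_goodWindowsAE` and
`PeriodicWindows_of_laminarity_saturation : LjLaminarity → LaminarSaturation → PeriodicWindows` (14293 ∧ 14294 ⇒ 3240),
over the landed stubs E0a `stub_goodLimit` (p136031), E0b1a `stub_hexClosure` (p135047), E0b1b `stub_levelLattice`
(p134939), E0b2 `stub_levelRegistry` (p135738), E0b3 `stub_barlowOfLevels` (p134978) and the rev-9 chain
`periodicWindows_of_barlowWindows` (p133057: E1 Barlow hull point, E2 shape/scale pinning, E3, item 11779). This file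
therefore imports that tree file and keeps exactly:

* S0' `stub_goodWindows` — the INPUT, the consequent of board item stmt-14294 `LaminarSaturation` VERBATIM (a.e. GOOD
  windows: `ε`-flat levels with gaps `≥ 19/25`, `19/20`-separation, exactly `6 + 3 + 3` neighbours within distance `1`
  with `ε`-sharp lengths `a` (in-level), `b` (adjacent levels), `a, b ∈ [19/20, 1]`); so S0' ⇐ 14293 ∧ 14294 by modus
  ponens (`h14294 h14293`). It is the ONLY `sorry`.
* `PeriodicWindows_of_oneGoodWindow` (proved in rev 11, LANDED p137396 in the imported tree file) — the WEAKEST sufficient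
  condition the landed chain supports, stated once for planners: if every ground-state sequence has, at every scale `R ≥ 2`, `ε > 0`, frequently in `N`, ONE
  particle with a GOOD `(R, ε)`-window, then `PeriodicWindows`. No a.e. statement, no energy clause, no laminarity of the
  whole configuration — one window per scale, infinitely often.
* `PeriodicWindows_of` — the composition, concluding `ChessboardParticlePlanes.PeriodicWindows` BY NAME from S0'.
-/

noncomputable section

namespace Summit.AtomisticToContinuum.Crystallization.Theorems.PeriodicWindowsSketch

open Literature.MathematicalPhysics.StatisticalMechanics Filter Metric
open Summit.AtomisticToContinuum.Crystallization.Theses.ChessboardParticlePlanes (PeriodicWindows)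
open Summit.AtomisticToContinuum.Crystallization.Theses.LaminarSixThreeThree (LjLaminarity LaminarSaturation)

/-! ## S0' — the INPUT stub: a.e. GOOD windows (consequent of board item stmt-14294 `LaminarSaturation`, verbatim) -/

/-- STUB S0' (INPUT = the consequent of board item stmt-AtomisticToContinuum-14294 `LaminarSaturation`, verbatim;
hence implied by 14293 `LjLaminarity` ∧ 14294): for every `R ≥ 2`, `ε > 0` and every sequence of Lennard-Jones
ground states, the fraction of particles without a GOOD `(R, ε)`-window tends to `0`. -/
theorem stub_goodWindows : ∀ R ε : ℝ, 2 ≤ R → 0 < ε → ∀ x : (N : ℕ) → (Fin N → EuclideanSpace ℝ (Fin 3)),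
    (∀ N, IsGroundState lennardJones (x N)) →
    Filter.Tendsto (fun N : ℕ => (Nat.card {i : Fin N // ¬ (∃ a b : ℝ, 19 / 20 ≤ a ∧ a ≤ 1 ∧ 19 / 20 ≤ b ∧
      b ≤ 1 ∧ ∃ n : EuclideanSpace ℝ (Fin 3), ‖n‖ = 1 ∧ ∃ c : ℤ → ℝ, (∀ k : ℤ, c k + 19 / 25 ≤ c (k + 1)) ∧
      ∃ l : Fin N → ℤ, (∀ j : Fin N, dist (x N j) (x N i) ≤ R → |inner ℝ (x N j - x N i) n - c (l j)| ≤ ε) ∧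
      (∀ j k : Fin N, dist (x N j) (x N i) ≤ R → dist (x N k) (x N i) ≤ R → j ≠ k → 19 / 20 ≤ dist (x N j) (x N k)) ∧
      ∀ j : Fin N, dist (x N j) (x N i) ≤ R / 2 →
        Nat.card {k : Fin N // k ≠ j ∧ l k = l j ∧ dist (x N j) (x N k) ≤ 1} = 6 ∧
        Nat.card {k : Fin N // l k = l j + 1 ∧ dist (x N j) (x N k) ≤ 1} = 3 ∧
        Nat.card {k : Fin N // l k = l j - 1 ∧ dist (x N j) (x N k) ≤ 1} = 3 ∧
        ∀ k : Fin N, k ≠ j → dist (x N j) (x N k) ≤ 1 →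
          (l k = l j → |dist (x N j) (x N k) - a| ≤ ε) ∧ (l k ≠ l j → |dist (x N j) (x N k) - b| ≤ ε))} : ℝ) / N)
      Filter.atTop (nhds 0) := by
  sorry

/-! ## COMPOSITION -/

/-- COMPOSITION (checked, no `sorry` of its own): the input stub S0' gives the crux `PeriodicWindows` BY NAME through
the landed bridge `PeriodicWindows_of_goodWindowsAE` (G1' counting + `barlowWindows_of_goodWindows` +
`periodicWindows_of_barlowWindows`). -/
theorem PeriodicWindows_of : PeriodicWindows := PeriodicWindows_of_goodWindowsAE stub_goodWindows

end Summit.AtomisticToContinuum.Crystallization.Theorems.PeriodicWindowsSketch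

end
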